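import Mathlib
import HarnessLib

/-!
# Entropy maximization in finite dimensions and the DAD theorem (Borwein–Zhu 2005, Ch. 4 §4.7)

A literature anchor for §4.7 *Entropy Maximization* of

* J. M. Borwein, Q. J. Zhu, *Techniques of Variational Analysis*, CMS Books in Mathematics 20,
  Springer 2005, Chapter 4 "Variational Techniques in Convex Analysis", §4.7, pp. 157–162
  [cite: BorweinZhu2005].

## Encoding (declared deviations from the printed text)

* §4.7.2, (4.7.3): the **Boltzmann–Shannon entropy function** `p(t) = t log t − t` (`t > 0`),
  `p(0) = 0`, `p(t) = +∞` (`t < 0`) is the real function `bsEntropy t = t * log t - t`; the value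
  `+∞` on `t < 0` is replaced by restricting every statement to `t ≥ 0` (there `bsEntropy` agrees
  with the book, and `bsEntropy 0 = 0`).  (4.7.4): `f(x) = Σₙ p(xₙ)` on `ℝ^N` is `bsSum x`, with
  `ℝ^N = ι → ℝ` for a finite index type `ι` (the book takes `ι = {1, …, N}`); its effective domain
  `dom f = ℝ^N_+` is `orthant ι = {x | ∀ i, 0 ≤ x i}` and `int ℝ^N_+ = {x | ∀ i, 0 < x i}`.
* Problem `FE` (p. 158): minimize `f(x) + ⟨c, x⟩` subject to `A x = b`, with `A : ℝ^N → ℝ^M` a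
  linear mapping, is encoded with a real matrix `A : Matrix κ ι ℝ` (`κ` finite), the cost
  `feCost c x = Σᵢ (p(xᵢ) + cᵢ xᵢ) = f(x) + ⟨c, x⟩` (`feCost_eq`) and the feasible region
  `feFeasible A b = {x | x ∈ dom f, A *ᵥ x = b}`; "`x̄` is a solution of `FE`" is
  `x̄ ∈ feFeasible A b ∧ IsMinOn (feCost c) (feFeasible A b) x̄`.  The transpose `Aᵀ φ` is written
  `φ ᵥ* A` (`= Aᵀ *ᵥ φ`, `Matrix.mulVec_transpose`); the final statement `entropyMaximization` is
  given with `Aᵀ *ᵥ φ`.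
* The dual problem of Theorem 4.7.3, `max_φ {⟨φ, b⟩ − (f + c)*(Aᵀ φ)}`, is written with the
  conjugate computed: `(f + c)*(y) = Σᵢ exp(yᵢ − cᵢ)` (Exercise 4.7.10, `p*(s) = eˢ`; proved here as
  `isGreatest_conj_feCost` / `mul_sub_bsEntropy_le_exp`), i.e. the dual objective is
  `feDual A b c φ = ⟨φ, b⟩ − Σᵢ exp((Aᵀ φ)ᵢ − cᵢ)`; "`φ̄` solves the dual" is
  `IsMaxOn (feDual A b c) univ φ̄`.
* Theorem 4.7.1 (duality for entropy maximization on a Banach space under `b ∈ core (A dom f)`,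
  via the Fenchel duality Theorem 4.4.3) is NOT formalised in its generality; its instance for
  problem `FE` — `inf FE = max dual` with dual attainment — is proved directly
  (`feCost_isLeast_isGreatest`, `exists_isMaxOn_feDual`): weak duality is the termwise Fenchel–Young
  inequality and the maximizing `φ̄` is the Lagrange multiplier of Exercise 4.7.6, obtained from the
  first-order condition at the interior minimizer and `(ker A)^⊥ = range Aᵀ` (a private
  linear-algebra helper; Mathlib's `LinearMap.range_dualMap_eq_dualAnnihilator_ker`).  Conversely
  every dual solution `φ̄` reproduces the primal solution by `x̄ = exp(Aᵀ φ̄ − c)`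
  (`eq_exp_of_isMaxOn_feDual`), which is the printed conclusion of Theorem 4.7.3.  Entries of
  `D₁ A D₂` are computed by Mathlib's `Matrix.mul_diagonal` / `Matrix.diagonal_mul` (the tree's
  `Literature.Analysis.OperatorTheory.DiagonalCongruenceNormConvex.diagonal_mul_mul_diagonal_apply`
  is not restated).  Proposition 4.7.2 (ii), `f′(x; z − x) = −∞` at a boundary point `x`
  towards an interior point `z`, is stated as divergence to `−∞` of the difference quotient
  (`tendsto_slope_feCost_atBot`); the proofs use the quantitative form `feCost_segment_sub_le`.
* §4.7.3 (p. 159): "`A` is doubly stochastic" is Mathlib's `A ∈ Matrix.doublyStochastic ℝ n`;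
  "`A` has a doubly stochastic pattern" (a doubly stochastic matrix with exactly the same zero
  entries) is `HasDoublyStochasticPattern A`.  Theorem 4.7.4 is stated for square matrices with
  nonnegative entries — the standing convention of §4.7.3 (cf. Exercise 4.7.9); for a matrix with a
  negative entry the printed equivalence fails (e.g. `A = (−1)`).  The necessity proof follows the
  book: the entropy problem on `ℝ^Z`, `Z = {(n, m) | a_{nm} > 0}` (the subtype `pattern A`), with
  the row/column-sum constraint matrix `dadMatrix A : Matrix (n ⊕ n) Z ℝ`, cost
  `c_{nm} = −log a_{nm}` and right-hand side `1`; the interior feasible point of Exercise 4.7.8 is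
  the pattern matrix itself.
* NOT formalised: Theorem 4.7.1 in general Banach spaces, §4.7.4 (Theorem 4.7.5, Proposition 4.7.6,
  Corollary 4.7.7: infinite-dimensional problems in `L¹(I)`), Exercises 4.7.1–4.7.3, 4.7.11–4.7.12.

## Main statements

* `bsEntropy`, `bsSum`, `strictConvexOn_bsEntropy`, `hasDerivAt_bsEntropy` — (4.7.3)/(4.7.4),
  p. 158.
* `mul_sub_bsEntropy_le_exp`, `mul_sub_bsEntropy_eq_exp_iff`, `isGreatest_conj_bsEntropy`,
  `isGreatest_conj_feCost` — Exercise 4.7.10 (`p*(s) = eˢ`) and `(f + c)*(y) = Σ exp(yᵢ − cᵢ)`.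
* `strictConvexOn_feCost`, `isCompact_sublevel_feCost`, `tendsto_slope_feCost_atBot` —
  Proposition 4.7.2 (i), (ii), p. 158.
* `exists_isMinOn_feCost`, `feCost_pos_of_isMinOn`, `eq_of_isMinOn_feCost`, `exists_multiplier`,
  `feDual_le_feCost`, `exists_isMaxOn_feDual`, `feCost_isLeast_isGreatest`,
  `eq_exp_of_isMaxOn_feDual`, `entropyMaximization` — Theorem 4.7.3 (with Exercises 4.7.5, 4.7.6),
  pp. 158–159.
* `HasDoublyStochasticPattern`, `hasDoublyStochasticPattern_of_diagonal_scaling` (Exercise 4.7.7),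
  `dadMatrix_mulVec_pattern` (Exercise 4.7.8), `exists_diagonal_scaling_of_pattern`,
  `dad_theorem` — Theorem 4.7.4 (matrices with doubly stochastic pattern / the DAD problem),
  pp. 159–160; `not_hasDoublyStochasticPattern_example` — Exercise 4.7.9.
-/

noncomputable section

open Real Finset Matrix Filter Topology

namespace Literature.Analysis.Convex.EntropyMaximization

variable {ι κ : Type*}

/-! ### §4.7.2 The Boltzmann–Shannon entropy function -/

/-- [cite: BorweinZhu2005, §4.7.2 (4.7.3), p. 158] The Boltzmann–Shannon entropy function
`p(t) = t log t − t` for `t ≥ 0` (so `p(0) = 0`); the printed value `+∞` for `t < 0` is replaced by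
the restriction of all statements to `t ≥ 0`. -/
def bsEntropy (t : ℝ) : ℝ := t * log t - t

/-- [cite: BorweinZhu2005, §4.7.2 (4.7.4), p. 158] `f(x) = Σₙ p(xₙ)` on `ℝ^N`. -/
def bsSum [Fintype ι] (x : ι → ℝ) : ℝ := ∑ i, bsEntropy (x i)

/-- [cite: BorweinZhu2005, §4.7.2, p. 158] The effective domain `ℝ^N_+` of `f`. -/
def orthant (ι : Type*) : Set (ι → ℝ) := {x | ∀ i, 0 ≤ x i}

/-- [cite: BorweinZhu2005, §4.7.2 problem FE, p. 158] One coordinate of the cost of `FE`: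
`p(t) + a t`. -/
def feTerm (a t : ℝ) : ℝ := bsEntropy t + a * t

/-- [cite: BorweinZhu2005, §4.7.2 problem FE, p. 158] The cost `f(x) + ⟨c, x⟩` of problem `FE`. -/
def feCost [Fintype ι] (c x : ι → ℝ) : ℝ := ∑ i, feTerm (c i) (x i)

/-- [cite: BorweinZhu2005, §4.7.2 problem FE, p. 158] The feasible region of `FE`:
`x ∈ dom f = ℝ^N_+` with `A x = b`. -/
def feFeasible [Fintype ι] (A : Matrix κ ι ℝ) (b : κ → ℝ) : Set (ι → ℝ) :=
  {x | (∀ i, 0 ≤ x i) ∧ A *ᵥ x = b}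

/-- [cite: BorweinZhu2005, §4.7.2 Theorem 4.7.3, p. 158] The dual objective
`⟨φ, b⟩ − (f + c)*(Aᵀ φ) = ⟨φ, b⟩ − Σₙ exp((Aᵀ φ)ₙ − cₙ)` (conjugate computed by
Exercise 4.7.10). -/
def feDual [Fintype ι] [Fintype κ] (A : Matrix κ ι ℝ) (b : κ → ℝ) (c : ι → ℝ) (φ : κ → ℝ) : ℝ :=
  φ ⬝ᵥ b - ∑ i, exp ((φ ᵥ* A) i - c i)

/-- [cite: BorweinZhu2005, §4.7.2 (4.7.3), p. 158] `p(0) = 0`. -/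
@[simp] theorem bsEntropy_zero : bsEntropy 0 = 0 := by simp [bsEntropy]

/-- [cite: BorweinZhu2005, §4.7.2 (4.7.3) / Exercise 4.7.10, pp. 158, 161–162] `p(eˢ) = s eˢ − eˢ`.
-/
theorem bsEntropy_exp (s : ℝ) : bsEntropy (exp s) = s * exp s - exp s := by
  simp [bsEntropy, mul_comm]

/-- [cite: BorweinZhu2005, §4.7.2 problem FE, p. 158] `p(0) + a·0 = 0`. -/
@[simp] theorem feTerm_zero (a : ℝ) : feTerm a 0 = 0 := by simp [feTerm]

/-- [cite: BorweinZhu2005, §4.7.2, p. 158] Membership in `ℝ^N_+`. -/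
theorem mem_orthant_iff {x : ι → ℝ} : x ∈ orthant ι ↔ ∀ i, 0 ≤ x i := Iff.rfl

/-- [cite: BorweinZhu2005, §4.7.2, p. 158] `ℝ^N_+ = dom f` is convex. -/
theorem convex_orthant : Convex ℝ (orthant ι) := by
  intro x hx y hy a b ha hb _ i
  simpa using add_nonneg (mul_nonneg ha (hx i)) (mul_nonneg hb (hy i))

/-- [cite: BorweinZhu2005, §4.7.2, p. 158] `ℝ^N_+ = dom f` is closed. -/
theorem isClosed_orthant : IsClosed (orthant ι) := by
  have : orthant ι = ⋂ i, {x : ι → ℝ | 0 ≤ x i} := by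
    ext x; simp [orthant]
  rw [this]
  exact isClosed_iInter fun i => isClosed_le continuous_const (continuous_apply i)

/-- [cite: BorweinZhu2005, §4.7.2 (4.7.3), p. 158] `p` is continuous on `[0, ∞)` (indeed on `ℝ`
for the real encoding). -/
theorem continuous_bsEntropy : Continuous bsEntropy :=
  continuous_mul_log.sub continuous_id

/-- [cite: BorweinZhu2005, §4.7.2 Proposition 4.7.2, p. 158] `t ↦ p(t) + a t` is continuous. -/
theorem continuous_feTerm (a : ℝ) : Continuous (feTerm a) :=
  continuous_bsEntropy.add (continuous_const.mul continuous_id)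

/-- [cite: BorweinZhu2005, §4.7.2 (4.7.3), p. 158] `p′(t) = log t` for `t > 0`. -/
theorem hasDerivAt_bsEntropy {t : ℝ} (ht : t ≠ 0) : HasDerivAt bsEntropy (log t) t := by
  have h := (hasDerivAt_mul_log ht).fun_sub (hasDerivAt_id t)
  simp only [id, add_sub_cancel_right] at h
  exact h

/-- [cite: BorweinZhu2005, §4.7.2 Theorem 4.7.3 (proof) / Exercise 4.7.5, pp. 159, 161–162]
`(p(t) + a t)′ = log t + a` for `t > 0` ("`x̄ ∈ int ℝ^N_+` where `f` is differentiable"). -/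
theorem hasDerivAt_feTerm (a : ℝ) {t : ℝ} (ht : t ≠ 0) :
    HasDerivAt (feTerm a) (log t + a) t := by
  have h := (hasDerivAt_bsEntropy ht).fun_add ((hasDerivAt_id t).const_mul a)
  simp only [id, mul_one] at h
  exact h

/-- [cite: BorweinZhu2005, §4.7.2 Proposition 4.7.2 (i), p. 158] `p` is strictly convex on
`[0, ∞)`. -/
theorem strictConvexOn_bsEntropy : StrictConvexOn ℝ (Set.Ici (0 : ℝ)) bsEntropy := by
  refine ⟨convex_Ici 0, fun x hx y hy hxy a b ha hb hab => ?_⟩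
  have h := strictConvexOn_mul_log.2 hx hy hxy ha hb hab
  simp only [bsEntropy, smul_eq_mul] at h ⊢
  linarith

/-- [cite: BorweinZhu2005, §4.7.2 Proposition 4.7.2 (i), p. 158] `p` is convex on `[0, ∞)`. -/
theorem convexOn_bsEntropy : ConvexOn ℝ (Set.Ici (0 : ℝ)) bsEntropy :=
  strictConvexOn_bsEntropy.convexOn

/-- [cite: BorweinZhu2005, §4.7.2 Proposition 4.7.2 (i), p. 158] `t ↦ p(t) + a t` is strictly
convex on `[0, ∞)`. -/
theorem strictConvexOn_feTerm (a : ℝ) : StrictConvexOn ℝ (Set.Ici (0 : ℝ)) (feTerm a) := by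
  refine ⟨convex_Ici 0, fun x hx y hy hxy p q hp hq hpq => ?_⟩
  have h := strictConvexOn_bsEntropy.2 hx hy hxy hp hq hpq
  simp only [feTerm, smul_eq_mul] at h ⊢
  have e : a * (p * x + q * y) = p * (a * x) + q * (a * y) := by ring
  linarith

/-- [cite: BorweinZhu2005, §4.7.2 Proposition 4.7.2 (i), p. 158] `t ↦ p(t) + a t` is convex on
`[0, ∞)`. -/
theorem convexOn_feTerm (a : ℝ) : ConvexOn ℝ (Set.Ici (0 : ℝ)) (feTerm a) :=
  (strictConvexOn_feTerm a).convexOn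

/-! ### Exercise 4.7.10: the conjugate of the Boltzmann–Shannon entropy is `exp` -/

/-- [cite: BorweinZhu2005, §4.7.5 Exercise 4.7.10, pp. 161–162] Fenchel–Young for `p`:
`s t − p(t) ≤ eˢ` for `t ≥ 0` (i.e. `p*(s) ≤ eˢ`). -/
theorem mul_sub_bsEntropy_le_exp (s : ℝ) {t : ℝ} (ht : 0 ≤ t) : s * t - bsEntropy t ≤ exp s := by
  rcases ht.eq_or_lt with rfl | ht
  · simp [(exp_pos s).le]
  · have hu : 0 < exp s / t := div_pos (exp_pos s) ht
    have h1 := log_le_sub_one_of_pos hu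
    rw [log_div (exp_pos s).ne' ht.ne', log_exp] at h1
    have h2 : t * (s - log t) ≤ t * (exp s / t - 1) := mul_le_mul_of_nonneg_left h1 ht.le
    have h3 : t * (exp s / t - 1) = exp s - t := by field_simp
    rw [h3] at h2
    simp only [bsEntropy]
    linarith

/-- [cite: BorweinZhu2005, §4.7.5 Exercise 4.7.10, pp. 161–162] Equality `s t − p(t) = eˢ` holds
exactly at `t = eˢ` (so `p*(s) = eˢ`, attained). -/
theorem mul_sub_bsEntropy_eq_exp_iff (s : ℝ) {t : ℝ} (ht : 0 ≤ t) :
    s * t - bsEntropy t = exp s ↔ t = exp s := by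
  constructor
  · intro h
    rcases ht.eq_or_lt with rfl | ht
    · simp at h
      exact absurd h (exp_pos s).ne
    · by_contra hne
      have hu : 0 < exp s / t := div_pos (exp_pos s) ht
      have hu1 : exp s / t ≠ 1 := by
        intro h1
        apply hne
        field_simp at h1
        linarith
      have h1 := log_lt_sub_one_of_pos hu hu1
      rw [log_div (exp_pos s).ne' ht.ne', log_exp] at h1
      have h2 : t * (s - log t) < t * (exp s / t - 1) := mul_lt_mul_of_pos_left h1 ht
      have h3 : t * (exp s / t - 1) = exp s - t := by field_simp
      rw [h3] at h2
      simp only [bsEntropy] at h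
      linarith
  · rintro rfl
    rw [bsEntropy_exp]
    ring

/-- [cite: BorweinZhu2005, §4.7.5 Exercise 4.7.10, pp. 161–162]
`p*(s) = sup_{t ≥ 0} (s t − p(t)) = eˢ`, the supremum being attained (at `t = eˢ`). -/
theorem isGreatest_conj_bsEntropy (s : ℝ) :
    IsGreatest ((fun t => s * t - bsEntropy t) '' Set.Ici 0) (exp s) := by
  refine ⟨⟨exp s, (exp_pos s).le, (mul_sub_bsEntropy_eq_exp_iff s (exp_pos s).le).2 rfl⟩, ?_⟩
  rintro _ ⟨t, ht, rfl⟩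
  exact mul_sub_bsEntropy_le_exp s ht

/-- [cite: BorweinZhu2005, §4.7.2 Proposition 4.7.2 (i) (proof: compact sublevel sets), p. 158]
A coordinate of the cost is bounded below linearly: `p(t) + a t ≥ t − exp(1 − a)` (`t ≥ 0`). -/
theorem sub_exp_le_feTerm (a : ℝ) {t : ℝ} (ht : 0 ≤ t) : t - exp (1 - a) ≤ feTerm a t := by
  have h := mul_sub_bsEntropy_le_exp (1 - a) ht
  simp only [feTerm]
  linarith

section FinDim

variable [Fintype ι]

/-- [cite: BorweinZhu2005, §4.7.2, p. 158] `f(x) + ⟨c, x⟩ = Σₙ (p(xₙ) + cₙ xₙ)`. -/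
theorem feCost_eq (c x : ι → ℝ) : feCost c x = bsSum x + c ⬝ᵥ x := by
  simp [feCost, feTerm, bsSum, dotProduct, Finset.sum_add_distrib]

/-- [cite: BorweinZhu2005, §4.7.2 Proposition 4.7.2, p. 158] `f + ⟨c, ·⟩` is continuous on
`ℝ^N` (in the real encoding). -/
theorem continuous_feCost (c : ι → ℝ) : Continuous (feCost c) :=
  continuous_finsetSum _ fun i _ => (continuous_feTerm (c i)).comp (continuous_apply i)

/-- [cite: BorweinZhu2005, §4.7.2 Theorem 4.7.3 / Exercise 4.7.10, pp. 158, 161–162] The conjugate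
of the cost of `FE`: `(f + c)*(y) = sup_{x ∈ ℝ^N_+} {⟨y, x⟩ − f(x) − ⟨c, x⟩} = Σₙ exp(yₙ − cₙ)`,
attained at `xₙ = exp(yₙ − cₙ)`. -/
theorem isGreatest_conj_feCost (c y : ι → ℝ) :
    IsGreatest ((fun x => y ⬝ᵥ x - feCost c x) '' orthant ι) (∑ i, exp (y i - c i)) := by
  constructor
  · refine ⟨fun i => exp (y i - c i), fun i => (exp_pos _).le, ?_⟩
    simp only [feCost, dotProduct, feTerm, ← Finset.sum_sub_distrib]
    refine Finset.sum_congr rfl fun i _ => ?_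
    have h := (mul_sub_bsEntropy_eq_exp_iff (y i - c i) (exp_pos (y i - c i)).le).2 rfl
    linarith
  · rintro _ ⟨x, hx, rfl⟩
    simp only [feCost, dotProduct, feTerm, ← Finset.sum_sub_distrib]
    refine Finset.sum_le_sum fun i _ => ?_
    have h := mul_sub_bsEntropy_le_exp (y i - c i) (hx i)
    linarith

/-! ### Proposition 4.7.2 -/

/-- [cite: BorweinZhu2005, §4.7.2 Proposition 4.7.2 (i), p. 158] For any `c ∈ ℝ^N`, `f(x) + ⟨c, x⟩`
is strictly convex on `ℝ^N_+`. -/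
theorem strictConvexOn_feCost (c : ι → ℝ) : StrictConvexOn ℝ (orthant ι) (feCost c) := by
  refine ⟨convex_orthant, fun x hx y hy hxy a b ha hb hab => ?_⟩
  obtain ⟨i₀, hi₀⟩ := Function.ne_iff.1 hxy
  have hle : ∀ i, feTerm (c i) (a * x i + b * y i) ≤
      a * feTerm (c i) (x i) + b * feTerm (c i) (y i) :=
    fun i => by simpa using (convexOn_feTerm (c i)).2 (hx i) (hy i) ha.le hb.le hab
  have hlt : feTerm (c i₀) (a * x i₀ + b * y i₀) <
      a * feTerm (c i₀) (x i₀) + b * feTerm (c i₀) (y i₀) := by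
    simpa using (strictConvexOn_feTerm (c i₀)).2 (hx i₀) (hy i₀) hi₀ ha hb hab
  calc feCost c (a • x + b • y) = ∑ i, feTerm (c i) (a * x i + b * y i) := by
        simp [feCost]
    _ < ∑ i, (a * feTerm (c i) (x i) + b * feTerm (c i) (y i)) :=
        Finset.sum_lt_sum (fun i _ => hle i) ⟨i₀, Finset.mem_univ _, hlt⟩
    _ = a • feCost c x + b • feCost c y := by
        simp [feCost, Finset.sum_add_distrib, Finset.mul_sum]

/-- [cite: BorweinZhu2005, §4.7.2 Proposition 4.7.2 (i) (proof: compact sublevel sets), p. 158]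
Coordinates are bounded on sublevel sets: `x ∈ ℝ^N_+`, `f(x) + ⟨c, x⟩ ≤ α` imply
`xᵢ ≤ α + Σⱼ exp(1 − cⱼ)`. -/
theorem apply_le_of_feCost_le {c x : ι → ℝ} (hx : ∀ i, 0 ≤ x i) {α : ℝ} (hα : feCost c x ≤ α)
    (i : ι) : x i ≤ α + ∑ j, exp (1 - c j) := by
  have h1 : ∑ j, (x j - exp (1 - c j)) ≤ feCost c x :=
    Finset.sum_le_sum fun j _ => sub_exp_le_feTerm (c j) (hx j)
  rw [Finset.sum_sub_distrib] at h1
  have h2 : x i ≤ ∑ j, x j :=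
    Finset.single_le_sum (f := x) (fun j _ => hx j) (Finset.mem_univ i)
  linarith

/-- [cite: BorweinZhu2005, §4.7.2 Proposition 4.7.2 (i), p. 158] `f(x) + ⟨c, x⟩` has compact
sublevel sets `{x ∈ ℝ^N_+ | f(x) + ⟨c, x⟩ ≤ α}`. -/
theorem isCompact_sublevel_feCost (c : ι → ℝ) (α : ℝ) :
    IsCompact {x : ι → ℝ | (∀ i, 0 ≤ x i) ∧ feCost c x ≤ α} := by
  have hclosed : IsClosed {x : ι → ℝ | (∀ i, 0 ≤ x i) ∧ feCost c x ≤ α} :=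
    isClosed_orthant.inter (isClosed_le (continuous_feCost c) continuous_const)
  refine (isCompact_Icc (a := (0 : ι → ℝ))
    (b := fun _ => α + ∑ j, exp (1 - c j))).of_isClosed_subset hclosed ?_
  rintro x ⟨hx, hα⟩
  exact ⟨fun i => hx i, fun i => apply_le_of_feCost_le hx hα i⟩

/-- [cite: BorweinZhu2005, §4.7.2 Proposition 4.7.2 (ii) (proof), p. 158] Quantitative one-sided
estimate along the segment from a boundary point `x` (`xᵢ = 0`) of `ℝ^N_+` towards an interior point
`z`: for some constant `K` and all `0 < t ≤ 1`,
`[f + c](x + t (z − x)) − [f + c](x) ≤ t (K + zᵢ log t)`. -/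
theorem feCost_segment_sub_le {c x z : ι → ℝ} (hx : ∀ j, 0 ≤ x j) (hz : ∀ j, 0 < z j) {i : ι}
    (hi : x i = 0) : ∃ K : ℝ, ∀ t : ℝ, 0 < t → t ≤ 1 →
      feCost c (x + t • (z - x)) - feCost c x ≤ t * (K + z i * log t) := by
  classical
  refine ⟨(∑ j ∈ univ.erase i, (feTerm (c j) (z j) - feTerm (c j) (x j))) +
    z i * (log (z i) - 1 + c i), fun t ht0 ht1 => ?_⟩
  have hseg : ∀ j, feTerm (c j) ((x + t • (z - x)) j) - feTerm (c j) (x j) ≤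
      t * (feTerm (c j) (z j) - feTerm (c j) (x j)) := by
    intro j
    have h := (convexOn_feTerm (c j)).2 (hx j) (hz j).le (sub_nonneg.2 ht1) ht0.le
      (sub_add_cancel 1 t)
    simp only [smul_eq_mul] at h
    have e : (x + t • (z - x)) j = (1 - t) * x j + t * z j := by
      simp only [Pi.add_apply, Pi.smul_apply, Pi.sub_apply, smul_eq_mul]; ring
    rw [e]
    linarith
  have hi' : feTerm (c i) ((x + t • (z - x)) i) - feTerm (c i) (x i) =
      t * (z i * (log (z i) - 1 + c i) + z i * log t) := by
    have e : (x + t • (z - x)) i = t * z i := by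
      simp only [Pi.add_apply, Pi.smul_apply, Pi.sub_apply, smul_eq_mul, hi]; ring
    rw [e, hi, feTerm_zero, feTerm, bsEntropy, log_mul ht0.ne' (hz i).ne']
    ring
  have hsplit : feCost c (x + t • (z - x)) - feCost c x =
      (∑ j ∈ univ.erase i, (feTerm (c j) ((x + t • (z - x)) j) - feTerm (c j) (x j))) +
        (feTerm (c i) ((x + t • (z - x)) i) - feTerm (c i) (x i)) := by
    simp only [feCost, ← Finset.sum_sub_distrib]
    rw [Finset.sum_erase_add _ _ (Finset.mem_univ i)]
  have hsum : ∑ j ∈ univ.erase i, (feTerm (c j) ((x + t • (z - x)) j) - feTerm (c j) (x j)) ≤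
      ∑ j ∈ univ.erase i, t * (feTerm (c j) (z j) - feTerm (c j) (x j)) :=
    Finset.sum_le_sum fun j _ => hseg j
  rw [← Finset.mul_sum] at hsum
  rw [hsplit, hi']
  linarith

/-- [cite: BorweinZhu2005, §4.7.2 Proposition 4.7.2 (ii), p. 158] For `z ∈ int ℝ^N_+` and `x` on the
boundary of `ℝ^N_+`, the directional derivative of `f + c` at `x` in the direction `z − x` is `−∞`:
the difference quotient `([f + c](x + t (z − x)) − [f + c](x)) / t` tends to `−∞` as `t ↓ 0`. -/
theorem tendsto_slope_feCost_atBot {c x z : ι → ℝ} (hx : ∀ j, 0 ≤ x j) (hz : ∀ j, 0 < z j)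
    {i : ι} (hi : x i = 0) :
    Tendsto (fun t : ℝ => (feCost c (x + t • (z - x)) - feCost c x) / t) (𝓝[>] 0) atBot := by
  obtain ⟨K, hK⟩ := feCost_segment_sub_le (c := c) hx hz hi
  have hKt : Tendsto (fun t : ℝ => K + z i * log t) (𝓝[>] 0) atBot :=
    tendsto_atBot_add_const_left _ _ (tendsto_log_nhdsGT_zero.const_mul_atBot (hz i))
  refine tendsto_atBot_mono' _ ?_ hKt
  filter_upwards [Ioc_mem_nhdsGT (zero_lt_one' ℝ)] with t ht
  rw [div_le_iff₀ ht.1]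
  have h := hK t ht.1 ht.2
  linarith

/-! ### Theorem 4.7.3: the finite dimensional entropy maximization problem `FE` -/

section FE

/-- [cite: BorweinZhu2005, §4.7.2 problem FE, p. 158] The feasible region of `FE` is closed. -/
theorem isClosed_feFeasible (A : Matrix κ ι ℝ) (b : κ → ℝ) : IsClosed (feFeasible A b) := by
  have hcont : Continuous fun x : ι → ℝ => A *ᵥ x :=
    Continuous.matrix_mulVec continuous_const continuous_id
  exact isClosed_orthant.inter (isClosed_eq hcont continuous_const)

variable {A : Matrix κ ι ℝ} {b : κ → ℝ} {c : ι → ℝ} {x y z : ι → ℝ}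

/-- [cite: BorweinZhu2005, §4.7.2 problem FE, p. 158] Feasibility for `FE`. -/
theorem mem_feFeasible_iff : x ∈ feFeasible A b ↔ (∀ i, 0 ≤ x i) ∧ A *ᵥ x = b := Iff.rfl

/-- [cite: BorweinZhu2005, §4.7.2 Theorem 4.7.3 (proof), p. 158] The feasible region of `FE` is
convex: it contains the segment from `x` towards `z`. -/
theorem segment_mem_feFeasible (hx : x ∈ feFeasible A b) (hz : z ∈ feFeasible A b) {t : ℝ}
    (ht0 : 0 ≤ t) (ht1 : t ≤ 1) : x + t • (z - x) ∈ feFeasible A b := by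
  refine ⟨fun j => ?_, ?_⟩
  · have e : (x + t • (z - x)) j = (1 - t) * x j + t * z j := by
      simp only [Pi.add_apply, Pi.smul_apply, Pi.sub_apply, smul_eq_mul]; ring
    rw [e]
    exact add_nonneg (mul_nonneg (sub_nonneg.2 ht1) (hx.1 j)) (mul_nonneg ht0 (hz.1 j))
  · rw [mulVec_add, mulVec_smul, mulVec_sub, hx.2, hz.2, sub_self, smul_zero, add_zero]

/-- [cite: BorweinZhu2005, §4.7.2 Theorem 4.7.3 (proof: existence), p. 158] If `FE` is feasible
then it has a solution (compactness of the sublevel sets, Proposition 4.7.2 (i)). -/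
theorem exists_isMinOn_feCost (hz : z ∈ feFeasible A b) :
    ∃ x ∈ feFeasible A b, IsMinOn (feCost c) (feFeasible A b) x := by
  set K := feFeasible A b ∩ {x : ι → ℝ | (∀ i, 0 ≤ x i) ∧ feCost c x ≤ feCost c z}
  have hK : IsCompact K :=
    (isCompact_sublevel_feCost c (feCost c z)).inter_left (isClosed_feFeasible A b)
  have hzK : z ∈ K := ⟨hz, hz.1, le_rfl⟩
  obtain ⟨x, hxK, hxmin⟩ := hK.exists_isMinOn ⟨z, hzK⟩ (continuous_feCost c).continuousOn
  refine ⟨x, hxK.1, fun y hy => ?_⟩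
  by_cases hyz : feCost c y ≤ feCost c z
  · exact hxmin ⟨hy, hy.1, hyz⟩
  · have h1 : feCost c x ≤ feCost c z := hxmin hzK
    rw [Set.mem_setOf_eq]
    linarith [not_le.1 hyz]

/-- [cite: BorweinZhu2005, §4.7.2 Theorem 4.7.3 (proof: interiority), p. 158] If the constraint is
satisfied at some `z ∈ int ℝ^N_+`, every solution of `FE` lies in `int ℝ^N_+`
(Proposition 4.7.2 (ii)). -/
theorem feCost_pos_of_isMinOn (hzpos : ∀ i, 0 < z i) (hz : A *ᵥ z = b) (hx : x ∈ feFeasible A b)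
    (hmin : IsMinOn (feCost c) (feFeasible A b) x) : ∀ i, 0 < x i := by
  have hzf : z ∈ feFeasible A b := ⟨fun i => (hzpos i).le, hz⟩
  intro i
  by_contra hneg
  have hi : x i = 0 := le_antisymm (not_lt.1 hneg) (hx.1 i)
  obtain ⟨K, hK⟩ := feCost_segment_sub_le (c := c) hx.1 hzpos hi
  set t := min (1 / 2 : ℝ) (exp (-(|K| + 1) / z i)) with ht_def
  have ht0 : 0 < t := lt_min (by norm_num) (exp_pos _)
  have ht1 : t ≤ 1 := (min_le_left _ _).trans (by norm_num)
  have hlog : z i * log t ≤ -(|K| + 1) := by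
    have h1 : log t ≤ -(|K| + 1) / z i := by
      rw [log_le_iff_le_exp ht0]
      exact min_le_right _ _
    have h2 := mul_le_mul_of_nonneg_left h1 (hzpos i).le
    rwa [mul_div_cancel₀ _ (hzpos i).ne'] at h2
  have hseg := hK t ht0 ht1
  have hKt : K + z i * log t ≤ -1 := by linarith [le_abs_self K]
  have h3 : t * (K + z i * log t) ≤ t * (-1) := mul_le_mul_of_nonneg_left hKt ht0.le
  have hlt : feCost c (x + t • (z - x)) < feCost c x := by linarith
  exact absurd (hmin (segment_mem_feFeasible hx hzf ht0.le ht1)) (not_le.2 hlt)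

/-- [cite: BorweinZhu2005, §4.7.2 Theorem 4.7.3 (proof: uniqueness), p. 158] Problem `FE` has at
most one solution (strict convexity, Proposition 4.7.2 (i)). -/
theorem eq_of_isMinOn_feCost (hx : x ∈ feFeasible A b) (hy : y ∈ feFeasible A b)
    (hxmin : IsMinOn (feCost c) (feFeasible A b) x)
    (hymin : IsMinOn (feCost c) (feFeasible A b) y) : x = y := by
  by_contra hne
  set m := (1 / 2 : ℝ) • x + (1 / 2 : ℝ) • y
  have hm : m ∈ feFeasible A b := by
    refine ⟨fun i => ?_, ?_⟩
    · simpa [m] using add_nonneg (mul_nonneg (by norm_num : (0 : ℝ) ≤ 1 / 2) (hx.1 i))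
        (mul_nonneg (by norm_num : (0 : ℝ) ≤ 1 / 2) (hy.1 i))
    · simp only [m, mulVec_add, mulVec_smul, hx.2, hy.2, ← add_smul]
      norm_num
  have hlt : feCost c m < (1 / 2 : ℝ) • feCost c x + (1 / 2 : ℝ) • feCost c y :=
    (strictConvexOn_feCost c).2 hx.1 hy.1 hne (by norm_num) (by norm_num) (by norm_num)
  have h1 : feCost c x ≤ feCost c m := hxmin hm
  have h2 : feCost c y ≤ feCost c m := hymin hm
  simp only [smul_eq_mul] at hlt
  linarith

/-- [cite: BorweinZhu2005, §4.7.2 Theorem 4.7.3 (proof) / Exercise 4.7.6, pp. 159, 161–162]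
First-order condition at an interior solution of `FE`: the gradient `f′(x̄) + c = log x̄ + c` is
orthogonal to `ker A`. -/
theorem sum_log_add_mul_eq_zero_of_isMinOn (hx : x ∈ feFeasible A b)
    (hmin : IsMinOn (feCost c) (feFeasible A b) x) (hpos : ∀ i, 0 < x i) {w : ι → ℝ}
    (hw : A *ᵥ w = 0) : ∑ i, (log (x i) + c i) * w i = 0 := by
  -- the cost along the line `x + t w`, which stays feasible for small `|t|`
  have hev : ∀ᶠ t : ℝ in 𝓝 0, x + t • w ∈ feFeasible A b := by
    have hpos' : ∀ i, ∀ᶠ t : ℝ in 𝓝 0, 0 < x i + t * w i := by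
      intro i
      have hc : Tendsto (fun t : ℝ => x i + t * w i) (𝓝 0) (𝓝 (x i)) := by
        have h1 : Continuous fun t : ℝ => x i + t * w i := by fun_prop
        simpa using h1.tendsto 0
      exact hc.eventually_const_lt (hpos i)
    filter_upwards [eventually_all.2 hpos'] with t ht
    refine ⟨fun i => ?_, ?_⟩
    · simpa using (ht i).le
    · rw [mulVec_add, mulVec_smul, hx.2, hw, smul_zero, add_zero]
  have hloc : IsLocalMin (fun t : ℝ => feCost c (x + t • w)) 0 := by
    filter_upwards [hev] with t ht
    simpa using hmin ht
  have hderiv : HasDerivAt (fun t : ℝ => feCost c (x + t • w))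
      (∑ i, (log (x i) + c i) * w i) 0 := by
    have hterm : ∀ i ∈ (univ : Finset ι), HasDerivAt (fun t : ℝ => feTerm (c i) ((x + t • w) i))
        ((log (x i) + c i) * w i) 0 := by
      intro i _
      have hs : HasDerivAt (fun t : ℝ => x i + t * w i) (w i) 0 := by
        simpa using ((hasDerivAt_mul_const (w i)).const_add (x i) : HasDerivAt
          (fun t : ℝ => x i + t * w i) (w i) 0)
      have hg : HasDerivAt (feTerm (c i)) (log (x i) + c i) (x i + 0 * w i) := by
        simpa using hasDerivAt_feTerm (c i) (hpos i).ne'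
      have hcomp := hg.comp (0 : ℝ) hs
      refine hcomp.congr_of_eventuallyEq (Filter.Eventually.of_forall fun t => ?_)
      simp [Function.comp]
    simpa [feCost] using HasDerivAt.fun_sum hterm
  exact hloc.hasDerivAt_eq_zero hderiv

section Dual

variable [Fintype κ]

/-- [folklore] The Lagrange-multiplier step of Theorem 4.7.3 / Exercise 4.7.6 as linear algebra:
a vector orthogonal to `ker M` lies in the range of `Mᵀ` (`(ker M)^⊥ = range Mᵀ` in `ℝ^N`, via
Mathlib's `LinearMap.range_dualMap_eq_dualAnnihilator_ker`).  Private helper: the tree's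
`Literature.Analysis.Convex.EqualityConstrainedQP.exists_transpose_mulVec_eq_of_forall_ker` is the
same fact with `Aᵀ *ᵥ ν` (that module is not loadable on the current farm snapshot, hence not
imported). -/
private theorem exists_vecMul_eq_of_forall_mulVec_eq_zero (M : Matrix κ ι ℝ) (v : ι → ℝ)
    (hv : ∀ w, M *ᵥ w = 0 → v ⬝ᵥ w = 0) : ∃ φ : κ → ℝ, φ ᵥ* M = v := by
  classical
  let f : (ι → ℝ) →ₗ[ℝ] (κ → ℝ) := M.mulVecLin
  let ψ : Module.Dual ℝ (ι → ℝ) :=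
    { toFun := fun w => v ⬝ᵥ w
      map_add' := fun w₁ w₂ => dotProduct_add v w₁ w₂
      map_smul' := fun r w => by simp [dotProduct_smul] }
  have hψ : ψ ∈ (LinearMap.ker f).dualAnnihilator := by
    rw [Submodule.mem_dualAnnihilator]
    intro w hw
    exact hv w (by simpa [f] using hw)
  rw [← LinearMap.range_dualMap_eq_dualAnnihilator_ker] at hψ
  obtain ⟨θ, hθ⟩ := hψ
  refine ⟨fun k => θ (fun j => if k = j then 1 else 0), funext fun i => ?_⟩
  have h1 : (f.dualMap θ) (Pi.single i 1) = ψ (Pi.single i 1) := by rw [hθ]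
  rw [LinearMap.dualMap_apply] at h1
  have h2 : ψ (Pi.single i 1) = v i := by
    show v ⬝ᵥ Pi.single i 1 = v i
    simp
  have h3 : f (Pi.single i 1) = fun k => M k i := by
    ext k
    simp [f, Matrix.mulVec, dotProduct, Pi.single_apply]
  rw [h2, h3, LinearMap.pi_apply_eq_sum_univ θ] at h1
  rw [← h1]
  simp only [vecMul, dotProduct, smul_eq_mul]
  exact Finset.sum_congr rfl fun k _ => mul_comm _ _

/-- [cite: BorweinZhu2005, §4.7.2 Theorem 4.7.3 / Exercises 4.7.5–4.7.6, pp. 158–159, 161–162] At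
the (interior) solution `x̄` of `FE` there is a Lagrange multiplier `φ̄ ∈ ℝ^M` with
`f′(x̄) + c = Aᵀ φ̄`, i.e. `x̄ₙ = exp(Aᵀ φ̄ − c)ₙ`. -/
theorem exists_multiplier (hzpos : ∀ i, 0 < z i) (hz : A *ᵥ z = b) (hx : x ∈ feFeasible A b)
    (hmin : IsMinOn (feCost c) (feFeasible A b) x) :
    ∃ φ : κ → ℝ, ∀ i, x i = exp ((φ ᵥ* A) i - c i) := by
  have hpos := feCost_pos_of_isMinOn hzpos hz hx hmin
  obtain ⟨φ, hφ⟩ := exists_vecMul_eq_of_forall_mulVec_eq_zero A (fun i => log (x i) + c i)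
    (fun w hw => by
      simpa [dotProduct] using sum_log_add_mul_eq_zero_of_isMinOn hx hmin hpos hw)
  refine ⟨φ, fun i => ?_⟩
  have h : (φ ᵥ* A) i = log (x i) + c i := congr_fun hφ i
  rw [h, add_sub_cancel_right, exp_log (hpos i)]

/-- [cite: BorweinZhu2005, §4.7.1 Theorem 4.7.1 / §4.7.2 Theorem 4.7.3 (weak duality),
pp. 157–158] For every feasible `x` and every `φ`, `⟨φ, b⟩ − (f + c)*(Aᵀ φ) ≤ f(x) + ⟨c, x⟩`. -/
theorem feDual_le_feCost (hx : x ∈ feFeasible A b) (φ : κ → ℝ) : feDual A b c φ ≤ feCost c x := by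
  have hb : φ ⬝ᵥ b = (φ ᵥ* A) ⬝ᵥ x := by rw [← hx.2, dotProduct_mulVec]
  rw [feDual, hb]
  simp only [feCost, dotProduct, feTerm, ← Finset.sum_sub_distrib]
  rw [← sub_nonneg, ← Finset.sum_sub_distrib]
  refine Finset.sum_nonneg fun i _ => ?_
  have h := mul_sub_bsEntropy_le_exp ((φ ᵥ* A) i - c i) (hx.1 i)
  nlinarith [h]

/-- [cite: BorweinZhu2005, §4.7.2 Theorem 4.7.3 (proof), pp. 158–159] Equality in weak duality
("`f(x̄) + ⟨c, x̄⟩ + (f + c)*(Aᵀ φ̄) = ⟨φ̄, b⟩`"): if `x = exp(Aᵀ φ − c)` is feasible then the dual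
objective at `φ` equals the cost at `x`. -/
theorem feDual_eq_feCost_of_eq_exp (hx : x ∈ feFeasible A b) {φ : κ → ℝ}
    (hφ : ∀ i, x i = exp ((φ ᵥ* A) i - c i)) : feDual A b c φ = feCost c x := by
  have hb : φ ⬝ᵥ b = (φ ᵥ* A) ⬝ᵥ x := by rw [← hx.2, dotProduct_mulVec]
  rw [feDual, hb]
  simp only [feCost, dotProduct, feTerm, ← Finset.sum_sub_distrib]
  refine Finset.sum_congr rfl fun i _ => ?_
  have h := (mul_sub_bsEntropy_eq_exp_iff ((φ ᵥ* A) i - c i) (hx.1 i)).2 (hφ i)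
  nlinarith [h]

/-- [cite: BorweinZhu2005, §4.7.1 Theorem 4.7.1 / §4.7.2 Theorem 4.7.3 (dual attainment),
pp. 157–158] Under the interior-point condition the dual problem
`max_φ {⟨φ, b⟩ − (f + c)*(Aᵀ φ)}` has a solution (the Lagrange multiplier at the primal
solution; Exercise 4.7.2). -/
theorem exists_isMaxOn_feDual (hzpos : ∀ i, 0 < z i) (hz : A *ᵥ z = b) :
    ∃ φ : κ → ℝ, IsMaxOn (feDual A b c) Set.univ φ := by
  obtain ⟨x, hx, hmin⟩ := exists_isMinOn_feCost (c := c) (z := z) ⟨fun i => (hzpos i).le, hz⟩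
  obtain ⟨φ, hφ⟩ := exists_multiplier hzpos hz hx hmin
  refine ⟨φ, fun φ' _ => ?_⟩
  rw [Set.mem_setOf_eq, feDual_eq_feCost_of_eq_exp hx hφ]
  exact feDual_le_feCost hx φ'

/-- [cite: BorweinZhu2005, §4.7.1 Theorem 4.7.1 (4.7.1) / §4.7.2 Theorem 4.7.3, pp. 157–159]
Strong duality for `FE`: at a solution `x̄` with multiplier `φ̄`,
`f(x̄) + ⟨c, x̄⟩ = min FE = max dual`, both attained. -/
theorem feCost_isLeast_isGreatest (hx : x ∈ feFeasible A b)
    (hmin : IsMinOn (feCost c) (feFeasible A b) x) {φ : κ → ℝ}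
    (hφ : ∀ i, x i = exp ((φ ᵥ* A) i - c i)) :
    IsLeast (feCost c '' feFeasible A b) (feCost c x) ∧
      IsGreatest (Set.range (feDual A b c)) (feCost c x) := by
  refine ⟨⟨⟨x, hx, rfl⟩, ?_⟩, ⟨⟨φ, feDual_eq_feCost_of_eq_exp hx hφ⟩, ?_⟩⟩
  · rintro _ ⟨y, hy, rfl⟩
    exact hmin hy
  · rintro _ ⟨φ', rfl⟩
    exact feDual_le_feCost hx φ'

/-- [cite: BorweinZhu2005, §4.7.2 Theorem 4.7.3, p. 158] The dual objective along the coordinate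
line `φ + t eₖ`. -/
theorem feDual_add_smul_single [DecidableEq κ] (φ : κ → ℝ) (k : κ) (t : ℝ) :
    feDual A b c (φ + t • Pi.single k 1) =
      φ ⬝ᵥ b + t * b k - ∑ i, exp ((φ ᵥ* A) i - c i + t * A k i) := by
  simp only [feDual, add_dotProduct, smul_dotProduct, single_dotProduct, one_mul, smul_eq_mul,
    add_vecMul, smul_vecMul, Pi.add_apply, Pi.smul_apply, single_one_vecMul, Matrix.row_apply]
  congr 1
  refine Finset.sum_congr rfl fun i _ => ?_
  ring_nf

/-- [cite: BorweinZhu2005, §4.7.2 Theorem 4.7.3, p. 158] The derivative of the dual objective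
along `φ + t eₖ` at `t = 0` is `bₖ − (A exp(Aᵀ φ − c))ₖ`. -/
theorem hasDerivAt_feDual_line [DecidableEq κ] (φ : κ → ℝ) (k : κ) :
    HasDerivAt (fun t : ℝ => feDual A b c (φ + t • Pi.single k 1))
      (b k - ∑ i, A k i * exp ((φ ᵥ* A) i - c i)) 0 := by
  have hlin : HasDerivAt (fun t : ℝ => φ ⬝ᵥ b + t * b k) (b k) 0 := by
    simpa using ((hasDerivAt_mul_const (b k)).const_add (φ ⬝ᵥ b) :
      HasDerivAt (fun t : ℝ => φ ⬝ᵥ b + t * b k) (b k) 0)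
  have hexp : ∀ i ∈ (univ : Finset ι),
      HasDerivAt (fun t : ℝ => exp ((φ ᵥ* A) i - c i + t * A k i))
        (A k i * exp ((φ ᵥ* A) i - c i)) 0 := by
    intro i _
    have h1 : HasDerivAt (fun t : ℝ => (φ ᵥ* A) i - c i + t * A k i) (A k i) 0 := by
      simpa using ((hasDerivAt_mul_const (A k i)).const_add ((φ ᵥ* A) i - c i) :
        HasDerivAt (fun t : ℝ => (φ ᵥ* A) i - c i + t * A k i) (A k i) 0)
    have h2 := h1.exp
    simp only [zero_mul, add_zero] at h2
    convert h2 using 1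
    ring
  have hsum := HasDerivAt.fun_sum hexp
  have e : (fun t : ℝ => feDual A b c (φ + t • Pi.single k 1)) =
      fun t => φ ⬝ᵥ b + t * b k - ∑ i, exp ((φ ᵥ* A) i - c i + t * A k i) :=
    funext fun t => feDual_add_smul_single φ k t
  rw [e]
  exact hlin.fun_sub hsum

/-- [cite: BorweinZhu2005, §4.7.2 Theorem 4.7.3, pp. 158–159] The printed conclusion: if `φ̄` is
ANY solution of the dual problem `max_φ {⟨φ, b⟩ − (f + c)*(Aᵀ φ)}`, then `x̄ = exp(Aᵀ φ̄ − c)` is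
feasible and is a solution of `FE` (so, by uniqueness, it is *the* solution). -/
theorem exp_mem_isMinOn_of_isMaxOn_feDual {φ : κ → ℝ} (hφ : IsMaxOn (feDual A b c) Set.univ φ) :
    (fun i => exp ((φ ᵥ* A) i - c i)) ∈ feFeasible A b ∧
      IsMinOn (feCost c) (feFeasible A b) (fun i => exp ((φ ᵥ* A) i - c i)) := by
  classical
  set x' : ι → ℝ := fun i => exp ((φ ᵥ* A) i - c i)
  have hfeas : x' ∈ feFeasible A b := by
    refine ⟨fun i => (exp_pos _).le, funext fun k => ?_⟩
    have hloc : IsLocalMax (fun t : ℝ => feDual A b c (φ + t • Pi.single k 1)) 0 :=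
      Filter.Eventually.of_forall fun t => by
        simpa using hφ (Set.mem_univ (φ + t • Pi.single k 1))
    have h0 := hloc.hasDerivAt_eq_zero (hasDerivAt_feDual_line φ k)
    simp only [mulVec, dotProduct, x']
    linarith
  refine ⟨hfeas, fun y hy => ?_⟩
  rw [Set.mem_setOf_eq, ← feDual_eq_feCost_of_eq_exp hfeas (fun i => rfl)]
  exact feDual_le_feCost hy φ

/-- [cite: BorweinZhu2005, §4.7.2 Theorem 4.7.3, pp. 158–159] If `x̄` solves `FE` and `φ̄` solves
the dual problem, then `x̄ₙ = exp(Aᵀ φ̄ − c)ₙ`, `n = 1, …, N`. -/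
theorem eq_exp_of_isMaxOn_feDual (hx : x ∈ feFeasible A b)
    (hmin : IsMinOn (feCost c) (feFeasible A b) x) {φ : κ → ℝ}
    (hφ : IsMaxOn (feDual A b c) Set.univ φ) : ∀ i, x i = exp ((φ ᵥ* A) i - c i) := by
  obtain ⟨hfeas, hmin'⟩ := exp_mem_isMinOn_of_isMaxOn_feDual (A := A) (b := b) (c := c) hφ
  exact fun i => congr_fun (eq_of_isMinOn_feCost hx hfeas hmin hmin') i

/-- [cite: BorweinZhu2005, §4.7.2 Theorem 4.7.3, pp. 158–159] **Theorem 4.7.3.** Suppose that there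
is `z ∈ int ℝ^N_+` with `A z = b`.  Then problem `FE` (minimize `f(x) + ⟨c, x⟩` subject to
`A x = b`, `f` the Boltzmann–Shannon entropy) has a unique solution `x̄`; `x̄ ∈ int ℝ^N_+`; the dual
problem `max_φ {⟨φ, b⟩ − (f + c)*(Aᵀ φ)}` has a solution; and for every dual solution `φ̄`,
`x̄ₙ = exp(Aᵀ φ̄ − c)ₙ`, `n = 1, …, N`. -/
theorem entropyMaximization (hzpos : ∀ i, 0 < z i) (hz : A *ᵥ z = b) :
    ∃ x ∈ feFeasible A b, IsMinOn (feCost c) (feFeasible A b) x ∧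
      (∀ y ∈ feFeasible A b, IsMinOn (feCost c) (feFeasible A b) y → y = x) ∧
      (∀ i, 0 < x i) ∧
      (∃ φ : κ → ℝ, IsMaxOn (feDual A b c) Set.univ φ) ∧
      ∀ φ : κ → ℝ, IsMaxOn (feDual A b c) Set.univ φ → ∀ i, x i = exp ((Aᵀ *ᵥ φ) i - c i) := by
  obtain ⟨x, hx, hmin⟩ := exists_isMinOn_feCost (c := c) (z := z) ⟨fun i => (hzpos i).le, hz⟩
  refine ⟨x, hx, hmin, fun y hy hymin => eq_of_isMinOn_feCost hy hx hymin hmin,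
    feCost_pos_of_isMinOn hzpos hz hx hmin, exists_isMaxOn_feDual hzpos hz, fun φ hφ i => ?_⟩
  rw [mulVec_transpose]
  exact eq_exp_of_isMaxOn_feDual hx hmin hφ i

end Dual

end FE

end FinDim

/-! ### §4.7.3 The DAD problem -/

section DAD

variable {n : Type*}

/-- [cite: BorweinZhu2005, §4.7.3, p. 159] A square matrix `A` *has a doubly stochastic pattern* if
there is a doubly stochastic matrix with exactly the same zero entries as `A`. -/
def HasDoublyStochasticPattern [Fintype n] [DecidableEq n] (A : Matrix n n ℝ) : Prop :=
  ∃ B ∈ doublyStochastic ℝ n, ∀ i j, B i j = 0 ↔ A i j = 0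

/-- [cite: BorweinZhu2005, §4.7.3 Theorem 4.7.4 (sufficiency) / Exercise 4.7.7, pp. 159, 161–162]
If `D₁ A D₂` is doubly stochastic for diagonal matrices `D₁, D₂` with strictly positive diagonal
entries, then `A` has a doubly stochastic pattern. -/
theorem hasDoublyStochasticPattern_of_diagonal_scaling [Fintype n] [DecidableEq n]
    {A : Matrix n n ℝ} {d₁ d₂ : n → ℝ} (hd₁ : ∀ i, 0 < d₁ i) (hd₂ : ∀ j, 0 < d₂ j)
    (h : diagonal d₁ * A * diagonal d₂ ∈ doublyStochastic ℝ n) : HasDoublyStochasticPattern A := by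
  refine ⟨_, h, fun i j => ?_⟩
  rw [mul_diagonal, diagonal_mul]
  simp [(hd₁ i).ne', (hd₂ j).ne']

/-- [cite: BorweinZhu2005, §4.7.3 Theorem 4.7.4 (proof), p. 159] The index set
`Z = {(n, m) | a_{nm} > 0}` of the positive entries of `A`. -/
abbrev pattern (A : Matrix n n ℝ) : Type _ := {p : n × n // 0 < A p.1 p.2}

/-- [cite: BorweinZhu2005, §4.7.3 Theorem 4.7.4 (proof), p. 159] The matrix `G : ℝ^Z → ℝ^{2N}` of
the linear equality constraints: row sums (`Sum.inl n`) and column sums (`Sum.inr m`). -/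
def dadMatrix [DecidableEq n] (A : Matrix n n ℝ) : Matrix (n ⊕ n) (pattern A) ℝ
  | Sum.inl i, z => if z.1.1 = i then 1 else 0
  | Sum.inr j, z => if z.1.2 = j then 1 else 0

/-- [cite: BorweinZhu2005, §4.7.3 Theorem 4.7.4 (proof), p. 160] Extension by zero of a vector
indexed by the pattern `Z` to an `n × n` matrix ("`b_{nm} = x̄_{nm}` for `(n, m) ∈ Z` and
`b_{nm} = 0` otherwise"). -/
def patternExtend (A : Matrix n n ℝ) (x : pattern A → ℝ) : Matrix n n ℝ :=
  Matrix.of fun i j => if h : 0 < A i j then x ⟨(i, j), h⟩ else 0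

/-- [cite: BorweinZhu2005, §4.7.3 Theorem 4.7.4 (proof), p. 160] The zero extension on `Z`. -/
theorem patternExtend_apply_of_pos {A : Matrix n n ℝ} (x : pattern A → ℝ) {i j : n}
    (h : 0 < A i j) : patternExtend A x i j = x ⟨(i, j), h⟩ := by
  simp [patternExtend, h]

/-- [cite: BorweinZhu2005, §4.7.3 Theorem 4.7.4 (proof), p. 160] The zero extension off `Z`. -/
theorem patternExtend_apply_of_not {A : Matrix n n ℝ} (x : pattern A → ℝ) {i j : n}
    (h : ¬ 0 < A i j) : patternExtend A x i j = 0 := by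
  simp [patternExtend, h]

/-- [cite: BorweinZhu2005, §4.7.3 Theorem 4.7.4 (proof), p. 160] The zero extension at a point of
`Z`. -/
theorem patternExtend_apply_val {A : Matrix n n ℝ} (x : pattern A → ℝ) (z : pattern A) :
    patternExtend A x z.1.1 z.1.2 = x z := by
  obtain ⟨⟨i, j⟩, h⟩ := z
  exact patternExtend_apply_of_pos x h

/-- [cite: BorweinZhu2005, §4.7.3 Theorem 4.7.4 (proof), pp. 159–160] A weighted sum over the
pattern `Z` is the weighted sum over all of `n × n` of the zero extension (the computation of
`⟨G x, φ̄⟩`). -/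
theorem sum_pattern_mul_eq [Fintype n] (A : Matrix n n ℝ) (x : pattern A → ℝ) (g : n × n → ℝ) :
    ∑ z : pattern A, g z.1 * x z = ∑ p : n × n, g p * patternExtend A x p.1 p.2 := by
  classical
  have h1 : ∑ z : pattern A, g z.1 * x z =
      ∑ z : pattern A, g z.1 * patternExtend A x z.1.1 z.1.2 :=
    Finset.sum_congr rfl fun z _ => by rw [patternExtend_apply_val]
  have h2 : ∑ p ∈ univ.filter (fun p : n × n => 0 < A p.1 p.2),
        g p * patternExtend A x p.1 p.2 =
      ∑ z : pattern A, g z.1 * patternExtend A x z.1.1 z.1.2 :=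
    Finset.sum_subtype (univ.filter (fun p : n × n => 0 < A p.1 p.2)) (by simp)
      (fun p : n × n => g p * patternExtend A x p.1 p.2)
  have h3 : ∑ p ∈ univ.filter (fun p : n × n => 0 < A p.1 p.2),
        g p * patternExtend A x p.1 p.2 =
      ∑ p : n × n, g p * patternExtend A x p.1 p.2 := by
    refine Finset.sum_subset (Finset.filter_subset _ _) fun p _ hp => ?_
    have hp' : ¬ 0 < A p.1 p.2 := by simpa using hp
    rw [patternExtend_apply_of_not x hp', mul_zero]
  rw [h1, ← h2, h3]

/-- [cite: BorweinZhu2005, §4.7.3 Theorem 4.7.4 (proof), pp. 159–160] The row-sum constraints: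
`(G x)_{inl i} = Σ_{m : (i, m) ∈ Z} x_{im}`. -/
theorem dadMatrix_mulVec_inl [Fintype n] [DecidableEq n] (A : Matrix n n ℝ) (x : pattern A → ℝ)
    (i : n) : (dadMatrix A *ᵥ x) (Sum.inl i) = ∑ j, patternExtend A x i j := by
  have h1 : (dadMatrix A *ᵥ x) (Sum.inl i) =
      ∑ z : pattern A, (if z.1.1 = i then (1 : ℝ) else 0) * x z := by
    simp [mulVec, dotProduct, dadMatrix]
  have h2 := sum_pattern_mul_eq A x (fun p => if p.1 = i then (1 : ℝ) else 0)
  have h3 : ∑ p : n × n, (if p.1 = i then (1 : ℝ) else 0) * patternExtend A x p.1 p.2 =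
      ∑ j, patternExtend A x i j := by
    rw [Fintype.sum_prod_type, Finset.sum_comm]
    simp [ite_mul]
  exact h1.trans (h2.trans h3)

/-- [cite: BorweinZhu2005, §4.7.3 Theorem 4.7.4 (proof), pp. 159–160] The column-sum constraints:
`(G x)_{inr j} = Σ_{n : (n, j) ∈ Z} x_{nj}`. -/
theorem dadMatrix_mulVec_inr [Fintype n] [DecidableEq n] (A : Matrix n n ℝ) (x : pattern A → ℝ)
    (j : n) : (dadMatrix A *ᵥ x) (Sum.inr j) = ∑ i, patternExtend A x i j := by
  have h1 : (dadMatrix A *ᵥ x) (Sum.inr j) =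
      ∑ z : pattern A, (if z.1.2 = j then (1 : ℝ) else 0) * x z := by
    simp [mulVec, dotProduct, dadMatrix]
  have h2 := sum_pattern_mul_eq A x (fun p => if p.2 = j then (1 : ℝ) else 0)
  have h3 : ∑ p : n × n, (if p.2 = j then (1 : ℝ) else 0) * patternExtend A x p.1 p.2 =
      ∑ i, patternExtend A x i j := by
    rw [Fintype.sum_prod_type]
    simp [ite_mul]
  exact h1.trans (h2.trans h3)

/-- [cite: BorweinZhu2005, §4.7.3 Theorem 4.7.4 (proof), p. 160] `(Gᵀ φ̄)_{nm} = λₙ + μₘ` for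
`φ̄ = (λ₁, …, λ_N, μ₁, …, μ_N)`. -/
theorem vecMul_dadMatrix [Fintype n] [DecidableEq n] (A : Matrix n n ℝ) (φ : n ⊕ n → ℝ)
    (z : pattern A) : (φ ᵥ* dadMatrix A) z = φ (Sum.inl z.1.1) + φ (Sum.inr z.1.2) := by
  simp only [vecMul, dotProduct, dadMatrix, Fintype.sum_sum_type, mul_ite, mul_one, mul_zero]
  simp

/-- [cite: BorweinZhu2005, §4.7.3 Theorem 4.7.4 (proof) / Exercise 4.7.8, pp. 159, 161–162] If
`A ≥ 0` has a doubly stochastic pattern witnessed by `B`, then `B` restricted to `Z` is a point of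
`int ℝ^Z_+` at which the constraints of the entropy problem are satisfied. -/
theorem dadMatrix_mulVec_pattern [Fintype n] [DecidableEq n] {A B : Matrix n n ℝ}
    (hB : B ∈ doublyStochastic ℝ n) (hBA : ∀ i j, B i j = 0 ↔ A i j = 0) (hA : ∀ i j, 0 ≤ A i j) :
    (∀ z : pattern A, 0 < B z.1.1 z.1.2) ∧
      dadMatrix A *ᵥ (fun z : pattern A => B z.1.1 z.1.2) = 1 := by
  have hext : patternExtend A (fun z : pattern A => B z.1.1 z.1.2) = B := by
    ext i j
    by_cases h : 0 < A i j
    · rw [patternExtend_apply_of_pos _ h]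
    · rw [patternExtend_apply_of_not _ h]
      have hA0 : A i j = 0 := le_antisymm (not_lt.1 h) (hA i j)
      exact ((hBA i j).2 hA0).symm
  refine ⟨fun z => ?_, funext fun r => ?_⟩
  · exact (nonneg_of_mem_doublyStochastic hB).lt_of_ne' fun h0 => (z.2).ne' ((hBA _ _).1 h0)
  · cases r with
    | inl i =>
      rw [dadMatrix_mulVec_inl, hext]
      simpa using sum_row_of_mem_doublyStochastic hB i
    | inr j =>
      rw [dadMatrix_mulVec_inr, hext]
      simpa using sum_col_of_mem_doublyStochastic hB j

/-- [cite: BorweinZhu2005, §4.7.3 Theorem 4.7.4 (necessity), pp. 159–160] If a square matrix with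
nonnegative entries has a doubly stochastic pattern, then `D₁ A D₂` is doubly stochastic for some
diagonal matrices `D₁ = diag(e^{λ₁}, …, e^{λ_N})`, `D₂ = diag(e^{μ₁}, …, e^{μ_N})` with strictly
positive diagonal entries — obtained from the solution `x̄_{nm} = a_{nm} e^{λₙ} e^{μₘ}` of the
entropy maximization problem on `ℝ^Z` (Theorem 4.7.3). -/
theorem exists_diagonal_scaling_of_pattern [Fintype n] [DecidableEq n] {A : Matrix n n ℝ}
    (hA : ∀ i j, 0 ≤ A i j) (hpat : HasDoublyStochasticPattern A) :
    ∃ d₁ d₂ : n → ℝ, (∀ i, 0 < d₁ i) ∧ (∀ j, 0 < d₂ j) ∧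
      diagonal d₁ * A * diagonal d₂ ∈ doublyStochastic ℝ n := by
  obtain ⟨B, hB, hBA⟩ := hpat
  obtain ⟨hzpos, hGz⟩ := dadMatrix_mulVec_pattern hB hBA hA
  -- the entropy maximization problem on `ℝ^Z`, cost `c_{nm} = -log a_{nm}`, right-hand side `1`
  obtain ⟨x, hx, hmin⟩ := exists_isMinOn_feCost (A := dadMatrix A) (b := 1)
    (c := fun z : pattern A => -log (A z.1.1 z.1.2)) (z := fun z : pattern A => B z.1.1 z.1.2)
    ⟨fun z => (hzpos z).le, hGz⟩
  obtain ⟨φ, hφ⟩ := exists_multiplier hzpos hGz hx hmin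
  refine ⟨fun i => exp (φ (Sum.inl i)), fun j => exp (φ (Sum.inr j)), fun i => exp_pos _,
    fun j => exp_pos _, ?_⟩
  -- the scaled matrix is the zero extension of the solution `x̄`
  have hext : patternExtend A x =
      diagonal (fun i => exp (φ (Sum.inl i))) * A * diagonal (fun j => exp (φ (Sum.inr j))) := by
    ext i j
    rw [mul_diagonal, diagonal_mul]
    by_cases h : 0 < A i j
    · rw [patternExtend_apply_of_pos _ h, hφ ⟨(i, j), h⟩, vecMul_dadMatrix]
      simp only [sub_neg_eq_add, exp_add, exp_log h]
      ring
    · rw [patternExtend_apply_of_not _ h, le_antisymm (not_lt.1 h) (hA i j)]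
      ring
  rw [mem_doublyStochastic_iff_sum, ← hext]
  refine ⟨fun i j => ?_, fun i => ?_, fun j => ?_⟩
  · by_cases h : 0 < A i j
    · rw [patternExtend_apply_of_pos _ h]; exact hx.1 _
    · rw [patternExtend_apply_of_not _ h]
  · rw [← dadMatrix_mulVec_inl, hx.2, Pi.one_apply]
  · rw [← dadMatrix_mulVec_inr, hx.2, Pi.one_apply]

/-- [cite: BorweinZhu2005, §4.7.3 Theorem 4.7.4, p. 159] **Theorem 4.7.4 (Matrices with Doubly
Stochastic Pattern).** A square matrix `A` with nonnegative entries has a doubly stochastic pattern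
if and only if there are diagonal matrices `D₁` and `D₂` with strictly positive diagonal entries
such that `D₁ A D₂` is doubly stochastic. -/
theorem dad_theorem [Fintype n] [DecidableEq n] {A : Matrix n n ℝ} (hA : ∀ i j, 0 ≤ A i j) :
    HasDoublyStochasticPattern A ↔
      ∃ d₁ d₂ : n → ℝ, (∀ i, 0 < d₁ i) ∧ (∀ j, 0 < d₂ j) ∧
        diagonal d₁ * A * diagonal d₂ ∈ doublyStochastic ℝ n :=
  ⟨exists_diagonal_scaling_of_pattern hA,
    fun ⟨_, _, hd₁, hd₂, h⟩ => hasDoublyStochasticPattern_of_diagonal_scaling hd₁ hd₂ h⟩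

/-- [cite: BorweinZhu2005, §4.7.5 Exercise 4.7.9, pp. 161–162] A square matrix with nonnegative
entries that does not have a doubly stochastic pattern: `A = (1 1; 0 1)`. -/
theorem not_hasDoublyStochasticPattern_example :
    ¬ HasDoublyStochasticPattern !![(1 : ℝ), 1; 0, 1] := by
  rintro ⟨B, hB, hBA⟩
  rw [mem_doublyStochastic_iff_sum] at hB
  obtain ⟨-, hrow, hcol⟩ := hB
  have h10 : B 1 0 = 0 := (hBA 1 0).2 (by simp)
  have h01 : B 0 1 ≠ 0 := fun h => by simpa using (hBA 0 1).1 h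
  have hc0 := hcol 0
  have hr0 := hrow 0
  simp [Fin.sum_univ_two] at hc0 hr0
  apply h01
  linarith

end DAD

end Literature.Analysis.Convex.EntropyMaximization
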